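import Mathlib

/-!
# Route BarrierLever — conjecture TT (stmt-ValiantsHypothesis-19152): PARABOLIC certificates,
# part 1 — the support lemma

Seat val-np-p2 gen 3 (memo HOME/val-np-p2/MEMO-p2g3.md §3, §5).  A *parabolic* matrix
`H : Matrix (Fin (h+h)) (Fin (h+h)) ℂ` is one whose second-half rows vanish on the first-half
columns, `H (natAdd h a) (castAdd h c) = 0` — i.e. `H = [[g¹, X], [0, g⁰]]` stabilises the span of
the first-half symbols.  For the transversal `ρ_f` (`b ↦ castAdd h b` on `f`, `natAdd h b` off `f`)
the minor `det H[ρ_f, ρ_{f'}]` then VANISHES unless `|f'| ≤ |f|`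
(`det_transversal_submatrix_eq_zero_of_card_lt`): the `|f'|` columns `castAdd h d, d ∈ f'` are
supported on the `|f|` rows `castAdd h b, b ∈ f`, so every Leibniz term has a zero factor
(pigeonhole).  Hence the pairing matrix of two transversal families under a parabolic `H` is block
lower-triangular with respect to member cardinality, with the GRADED pieces
`det g¹[f, f'] · det g⁰[fᶜ, f'ᶜ]` on the diagonal.  CENSUS (seat folder, kit j255171): with generic
`g¹, g⁰, X` and rows = the family whose cardinality tail dominates, such an `H` certifies every
locked pair of complexes at `h = 5` (`r ≤ 16`, 32 455 pairs), `h = 6` (`r ≤ 9`), every nested-tail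
ordered pair of complexes at `h = 4` and `h = 5` (`r ≤ 9`, 62 100 pairs) and all sampled nested-tail
pairs of arbitrary families — the proposed two-lemma target (P) ∧ (N) ⇒ TT of the memo.

Definition-free, Mathlib only.  WHAT THIS IS NOT: only the vanishing half of the block structure;
no nonvanishing statement, no proof of TT; nothing on crux 14610 or VP versus VNP.
-/

-- layout Summits/ValiantsHypothesis/ValiantsHypothesis forces the duplicated namespace component
set_option linter.dupNamespace false

open Matrix Finset

namespace Summit.ValiantsHypothesis.ValiantsHypothesis.Theorems.BarrierLever.Compression

/-- SUPPORT LEMMA for parabolic certificates.  If `H` vanishes on (second-half rows) ×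
(first-half columns), then the transversal minor `det H[ρ_f, ρ_{f'}]` is zero as soon as
`|f| < |f'|`. -/
theorem det_transversal_submatrix_eq_zero_of_card_lt (h : ℕ)
    (H : Matrix (Fin (h + h)) (Fin (h + h)) ℂ)
    (hH : ∀ a c : Fin h, H (Fin.natAdd h a) (Fin.castAdd h c) = 0)
    (f f' : Finset (Fin h)) (hlt : f.card < f'.card) :
    (H.submatrix (fun b : Fin h => if b ∈ f then Fin.castAdd h b else Fin.natAdd h b)
      (fun d : Fin h => if d ∈ f' then Fin.castAdd h d else Fin.natAdd h d)).det = 0 := by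
  classical
  rw [Matrix.det_apply']
  refine Finset.sum_eq_zero fun σ _ => ?_
  -- some column `d ∈ f'` is sent by `σ` to a row outside `f`
  have hex : ∃ d ∈ f', σ d ∉ f := by
    by_contra hall
    push Not at hall
    have hle : f'.card ≤ f.card := by
      refine Finset.card_le_card_of_injOn σ (fun d hd => hall d (Finset.mem_coe.mp hd)) ?_
      intro x _ y _ hxy
      exact σ.injective hxy
    omega
  obtain ⟨d, hd, hσd⟩ := hex
  have hzero : (H.submatrix (fun b : Fin h => if b ∈ f then Fin.castAdd h b else Fin.natAdd h b)
      (fun d : Fin h => if d ∈ f' then Fin.castAdd h d else Fin.natAdd h d)) (σ d) d = 0 := by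
    simp only [submatrix_apply, if_neg hσd, if_pos hd]
    exact hH _ _
  have hprod : ∏ i, (H.submatrix (fun b : Fin h => if b ∈ f then Fin.castAdd h b else Fin.natAdd h b)
      (fun d : Fin h => if d ∈ f' then Fin.castAdd h d else Fin.natAdd h d)) (σ i) i = 0 :=
    Finset.prod_eq_zero (Finset.mem_univ d) hzero
  rw [hprod, mul_zero]

/-- The same vanishing for the item's column convention `τ_w` (`natAdd h c` on `w`, `castAdd h c`
off `w`): under a parabolic `H`, `det H[ρ_u, τ_w] = 0` whenever `|u| + |w| < h` (the column
transversal `τ_w` has `h - |w|` first-half symbols). -/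
theorem det_layout_entry_eq_zero_of_card_add_lt (h : ℕ)
    (H : Matrix (Fin (h + h)) (Fin (h + h)) ℂ)
    (hH : ∀ a c : Fin h, H (Fin.natAdd h a) (Fin.castAdd h c) = 0)
    (u w : Finset (Fin h)) (hlt : u.card + w.card < h) :
    (H.submatrix (fun b : Fin h => if b ∈ u then Fin.castAdd h b else Fin.natAdd h b)
      (fun c : Fin h => if c ∈ w then Fin.natAdd h c else Fin.castAdd h c)).det = 0 := by
  classical
  have hcol : (fun c : Fin h => if c ∈ w then Fin.natAdd h c else Fin.castAdd h c) =
      (fun c : Fin h => if c ∈ wᶜ then Fin.castAdd h c else Fin.natAdd h c) := by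
    funext c
    by_cases hc : c ∈ w
    · rw [if_pos hc, if_neg (by simpa using hc)]
    · rw [if_neg hc, if_pos (Finset.mem_compl.mpr hc)]
  rw [hcol]
  refine det_transversal_submatrix_eq_zero_of_card_lt h H hH u wᶜ ?_
  rw [Finset.card_compl, Fintype.card_fin]
  have := Finset.card_le_univ w
  rw [Fintype.card_fin] at this
  omega

end Summit.ValiantsHypothesis.ValiantsHypothesis.Theorems.BarrierLever.Compression
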